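import Summits.BirchSwinnertonDyer.Rank1Residual.X11b.RankOneNonsplitDisegni
import Literature.NumberTheory.EllipticCurves.Disegni2020.PAdicBSDRankOneSplit
import HarnessLib

/-!
# X11b at a SPLIT multiplicative prime `p ≥ 5` with a ramified second multiplicative prime: Mazur's
# main conjecture (Skinner 2016 Thm. A) + the exact exceptional-zero leading term (Disegni 2020 Thm. 4
# (ii) ⇐ Venerucci 2016) + Jones ⟹ `BSD(E,p)` modulo the Schneider certificate; and both types at once
# (cell `b2b-bsdres`, lane CLASS-CLOSURE, seat `cc-typer-6`; POINTER for the N8 owners x11b3 / cc-typer-3)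

HONEST FRAMING (run/shared/lean/b2b/bsd-rank1-residual/, verbatim in every file): the goal of the
cell is to DELETE the COMBINATION-SHAPED residual classes of the Birch–Swinnerton-Dyer formula for
ALL analytic-rank `≤ 1` elliptic curves over `ℚ` — "full BSD formula for every rank `≤ 1` curve in
class `C`" assembled STRICTLY from published theorems — so that the rank-`≤ 1` remainder becomes
exactly the CONSTRUCTION-SHAPED classes, which are TYPED (missing-input `Prop`s), NOT attempted.
This is not "finishing BSD". Research routes; NO CLAIM BEYOND STATED CLASSES; nothing here changes a
label (X11b / N8 stays CONSTRUCTION-SHAPED until the referee rules). THEOREMS ONLY (no definition, no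
new named fact): every published theorem enters as one of the tree's existing named Literature facts
BY NAME; the Schneider certificate is a PER-PAIR hypothesis; nothing about any curve is asserted.

## What this file records (companion of `X11b/RankOneNonsplitDisegni.lean`, p250147)

* `bsdp_of_split_of_analyticRank_eq_one_of_mazurMainConjectureAt_of_schneider` — `E/ℚ`, `p ≥ 5` SPLIT
  multiplicative, `E[p]` irreducible, a second multiplicative prime, `ord_{s=1} L(E,s) = 1`: Mazur's MC
  at the pair (`X2.MazurMainConjectureAt`) + Schneider's non-degeneracy of THE §4.2 split height ⟹
  `BSD(E,p)` — Disegni 2020 Thm. 4 (ii) (`hDex`, vendored `padicBSD_rankOne_splitMult_of_irreducible`,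
  Venerucci's irreducibility explicit), Stein–Wuthrich 2013 Thm. 6.1 split (`hJs`), SW §4.2 height
  existence (`hHs`), Gross–Zagier (`hGZ`), GZK, modularity; `𝓛_p ≠ 0` and the Tate parameter are tree
  theorems; engine `X2.certificate_iff_schneider_and_bsdp_of_mazurMainConjectureAt_split`.
* **`X11b.bsdp_of_ram_of_split_of_five_le_of_schneider`** — `ClassX11b W p ∧ Ram W p ∧ split ∧ 5 ≤ p`
  ⟹ `BSD(E,p)` from PUBLISHED facts modulo the pair's Schneider certificate (`ord_{T=0} L_p = 2`
  exactly); the (ram) prime IS the second multiplicative prime Disegni needs, and Skinner 2016 Thm. A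
  gives the MC (`X2.mazurMainConjectureAt_of_thmA`).
* **`X11b.bsdp_of_ram_of_five_le_of_schneider`** — both reduction types: `ClassX11b ∧ Ram ∧ 5 ≤ p`
  ⟹ `BSD(E,p)` modulo the Schneider certificate of the relevant §4.2 height (split / non-split).
  READING FLAGS that ride (referee A's to weigh): Disegni's split clause rests on Venerucci 2016
  (Beilinson–Kato elements + Hida theory) and on Disegni's determination of constants (§3.2.2); the
  non-split clause on Disegni 2017 Thm. B; both heights identified with SW §4.2 (Nekovář = Schneider
  norm-adapted = Mazur–Tate, non-exceptional / MTT split form via Disegni Prop. 3.2).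

References: [Disegni2020] Thm. 4, Props. 3.2–3.6; [Venerucci2015] §1, Thm. D; [Skinner2016PacificMC]
Thm. A; [SteinWuthrich2013] Thm. 6.1, §4.2; [MazurTateTeitelbaum1986Invent] §II.10; [Miller2011LMS]
Def. 1.1, Prop. 7.6; RESIDUAL-MAP.md §I N8; CLASS-CLOSURE-PLAN.md §3.10.
-/

set_option autoImplicit false

noncomputable section

open scoped Classical MatrixGroups ModularForm

open PowerSeries CongruenceSubgroup WeierstrassCurve Literature.NumberTheory.EllipticCurves
  Literature.NumberTheory.EllipticCurves.ModularForms
  Literature.NumberTheory.EllipticCurves.Rank1Residual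
  Literature.NumberTheory.EllipticCurves.Rank1Residual.Typed
  Literature.NumberTheory.EllipticCurves.Skinner2016
  Literature.NumberTheory.EllipticCurves.Wuthrich2014
  Literature.NumberTheory.EllipticCurves.SteinWuthrich2013
  Literature.NumberTheory.EllipticCurves.Disegni2020

namespace Summit.BirchSwinnertonDyer.Rank1Residual

/-! ## §1. Split multiplicative `p ≥ 5`, rank one, irreducible: MC + Schneider ⟹ `BSD(E,p)` -/

/-- **Rank one at a SPLIT multiplicative prime `p ≥ 5`, `E[p]` irreducible, a second multiplicative
prime: Mazur's main conjecture at the pair + the Schneider certificate of THE §4.2 split height ⟹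
`BSD(E,p)`, from PUBLISHED facts** — the exceptional-zero leading term is Disegni 2020 Thm. 4 (ii)
(`hDex`, with Venerucci's irreducibility explicit), the algebraic side Stein–Wuthrich Thm. 6.1 (`hJs`);
height existence `hHs`, Gross–Zagier `hGZ`, GZK `hGZK`, modularity `hpar`; the data (cyclotomic pair,
`X(E/ℚ_∞)`, newform and `ϖ`, THE split Mazur–Tate–Teitelbaum function, the Tate parameter) are
instantiated from tree theorems; engine `X2.certificate_iff_schneider_and_bsdp_of_mazurMainConjectureAt_split`.
[cite: Disegni2020, Thm. 4 (ii) (§3.2)] [cite: Venerucci2015, Thm. D]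
[cite: SteinWuthrich2013, Thm. 6.1 (p. 20) and §4.2] [cite: Miller2011LMS, Def. 1.1 and Prop. 7.6] -/
theorem bsdp_of_split_of_analyticRank_eq_one_of_mazurMainConjectureAt_of_schneider
    (hDex : padicBSD_rankOne_splitMult_of_irreducible) (hJs : thm61_splitMultiplicative)
    (hHs : exists_isSplitMultCanonical) (hGZ : GrossZagier1986_thm_I_7_3)
    (hGZK : rank_eq_analyticRank_of_analyticRank_le_one) (hpar : nonempty_modularParametrizationData)
    (W : WeierstrassCurve ℚ) [W.IsElliptic] [W.IsGloballyMinimal] (p : ℕ) [Fact p.Prime]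
    (hp5 : 5 ≤ p) (hsplit : W.HasSplitMultiplicativeReductionAtPrime p)
    (hirr : W.HasIrreducibleModPGaloisRep p)
    (hℓ : ∃ ℓ : ℕ, ∃ _ : Fact ℓ.Prime, ℓ ≠ p ∧ W.HasMultiplicativeReductionAtPrime ℓ)
    (hr1 : W.analyticRank = 1) (hMC : X2.MazurMainConjectureAt W p)
    (hSch : ∀ (Dq : TateParameterData W p) (Dh : PAdicHeightData W p),
      IsSplitMultCanonical Dh Dq → SchneiderConjecture Dh) :
    BSDp W p := by
  have hp2 : p ≠ 2 := by omega
  obtain ⟨κ, hκ, γ, hγ, hγ'⟩ := exists_isCyclotomic_isTopGenerator_isCyclotomicVariable_holds p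
  obtain ⟨D⟩ := W.nonempty_selmerDualData_holds κ γ hγ
  haveI : NeZero (W.conductorNorm ℤ) := ⟨(W.conductorNorm_pos_holds).ne'⟩
  obtain ⟨Dm⟩ := hpar W
  obtain ⟨ϖ, hϖpos, hϖ, -⟩ := Dm.exists_rat_mul_realPeriodRat_eq_plusPeriod
  obtain ⟨L, hL⟩ := exists_isSplitMultPAdicLFunctionOf hsplit Dm.isNewformOf
  obtain ⟨Dq⟩ := (nonempty_tateParameterData_iff_holds (W := W) (p := p)).mpr hsplit
  obtain ⟨Dh, hDh⟩ := hHs W p hp2 Dq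
  obtain ⟨s, hs⟩ := X2.exists_rat_shaAn_eq_of_analyticRank_eq_one hGZ hGZK W hr1
  have hrank : W.mordellWeilRank = 1 := by rw [(hGZK W hr1.le).1, hr1]
  have hReg : padicRegulator Dh ≠ 0 := hSch Dq Dh hDh
  obtain ⟨hord, hval⟩ :=
    (hDex W p hp5 hsplit hirr hℓ hr1 κ γ hκ hγ hγ' Dm.f Dm.isNewformOf ϖ hϖ L hL Dq Dh hDh s hs).2 hReg
  exact ((X2.certificate_iff_schneider_and_bsdp_of_mazurMainConjectureAt_split hJs hGZK W p hp2 hr1.le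
    hMC Dq hDh hκ hγ hγ' Dm.isNewformOf D ϖ hϖpos.ne' hϖ L hL hs).mp
      ⟨by rw [hrank]; exact hord, by rw [hrank]; exact hval⟩).2

/-! ## §2. X11b ∩ (ram): the split prime `p ≥ 5`, and both types together -/

namespace X11b

/-- **X11b ∧ (ram) ∧ SPLIT `p ≥ 5` ⟹ `BSD(E,p)` from PUBLISHED facts, modulo the pair's Schneider
certificate** (`ord_{T=0} L_p(E,T) = 2` exactly for THE split Mazur–Tate–Teitelbaum function): the
(ram) prime `ℓ ‖ N`, `ℓ ≠ p` is the second multiplicative prime of Disegni 2020 Thm. 4 (ii) (`hDex`),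
`E[p]` is irreducible on X11b (Venerucci's hypothesis), and Skinner 2016 Thm. A (`hA`) gives Mazur's MC
at the pair (`X2.mazurMainConjectureAt_of_thmA`). No Heegner point, no STEP L, no preprint. A pointer
for the N8 owners; no label changes. [cite: Skinner2016PacificMC, Thm. A]
[cite: Disegni2020, Thm. 4 (ii) (§3.2)] [cite: Venerucci2015, Thm. D]
[cite: SteinWuthrich2013, Thm. 6.1 (p. 20) and §4.2] -/
theorem bsdp_of_ram_of_split_of_five_le_of_schneider (hA : thmA_charIdeal_multiplicative)
    (hDex : padicBSD_rankOne_splitMult_of_irreducible) (hJs : thm61_splitMultiplicative)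
    (hHs : exists_isSplitMultCanonical) (hGZ : GrossZagier1986_thm_I_7_3)
    (hGZK : rank_eq_analyticRank_of_analyticRank_le_one) (hpar : nonempty_modularParametrizationData)
    (W : WeierstrassCurve ℚ) [W.IsElliptic] [W.IsGloballyMinimal] (p : ℕ) [Fact p.Prime]
    (hX : ClassX11b W p) (hram : Ram W p) (hsplit : W.HasSplitMultiplicativeReductionAtPrime p)
    (hp5 : 5 ≤ p)
    (hSch : ∀ (Dq : TateParameterData W p) (Dh : PAdicHeightData W p),
      IsSplitMultCanonical Dh Dq → SchneiderConjecture Dh) :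
    BSDp W p := by
  obtain ⟨hr1, -, hmult, hirr⟩ := hX
  have hℓ : ∃ ℓ : ℕ, ∃ _ : Fact ℓ.Prime, ℓ ≠ p ∧ W.HasMultiplicativeReductionAtPrime ℓ := by
    obtain ⟨ℓ, hℓ, hne, hmℓ, -⟩ := hram
    exact ⟨ℓ, hℓ, hne, hmℓ⟩
  exact bsdp_of_split_of_analyticRank_eq_one_of_mazurMainConjectureAt_of_schneider hDex hJs hHs hGZ hGZK
    hpar W p hp5 hsplit hirr hℓ hr1 (X2.mazurMainConjectureAt_of_thmA hA (by omega) hmult hirr hram) hSch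

/-- **X11b ∧ (ram) ∧ `p ≥ 5`, EITHER reduction type ⟹ `BSD(E,p)` from PUBLISHED facts, modulo the
pair's Schneider certificate** for THE Stein–Wuthrich §4.2 height of the relevant type (`hSchS` split /
`hSchN` non-split; only the matching one is used): split by `bsdp_of_ram_of_split_of_five_le_of_schneider`
(Disegni 2020 Thm. 4 (ii) ⇐ Venerucci), non-split by `bsdp_of_ram_of_not_split_of_schneider` (Disegni
2020 Thm. 4 (i), any odd `p`). Census scope (RESIDUAL-MAP §I N8): X11b at `p ≥ 5` with (ram) — the bulk
of the 4 203 sweep pairs. No label changes; the referee weighs the reading flags listed in the module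
docstring. [cite: Skinner2016PacificMC, Thm. A] [cite: Disegni2020, Thm. 4 (§3.2)]
[cite: SteinWuthrich2013, Thm. 6.1 (p. 20), §3.1 (p. 9), §4.2] -/
theorem bsdp_of_ram_of_five_le_of_schneider (hA : thmA_charIdeal_multiplicative)
    (hDis : padicBSD_rankOne_nonsplitMult) (hDex : padicBSD_rankOne_splitMult_of_irreducible)
    (hJs : thm61_splitMultiplicative) (hJn : thm61_nonsplitMultiplicative)
    (hHs : exists_isSplitMultCanonical) (hHn : exists_isMultCanonical)
    (hGZ : GrossZagier1986_thm_I_7_3) (hGZK : rank_eq_analyticRank_of_analyticRank_le_one)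
    (hpar : nonempty_modularParametrizationData)
    (W : WeierstrassCurve ℚ) [W.IsElliptic] [W.IsGloballyMinimal] (p : ℕ) [Fact p.Prime]
    (hX : ClassX11b W p) (hram : Ram W p) (hp5 : 5 ≤ p)
    (hSchS : ∀ (Dq : TateParameterData W p) (Dh : PAdicHeightData W p),
      IsSplitMultCanonical Dh Dq → SchneiderConjecture Dh)
    (hSchN : ∀ (q : ℚ_[p]) (Dh : PAdicHeightData W p), q ≠ 0 → ‖q‖ < 1 → tateJ q = (W.j : ℚ_[p]) →
      IsMultCanonical Dh q → SchneiderConjecture Dh) :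
    BSDp W p := by
  by_cases hsplit : W.HasSplitMultiplicativeReductionAtPrime p
  · exact bsdp_of_ram_of_split_of_five_le_of_schneider hA hDex hJs hHs hGZ hGZK hpar W p hX hram hsplit
      hp5 hSchS
  · exact bsdp_of_ram_of_not_split_of_schneider hA hDis hJn hHn hGZ hGZK hpar W p hX hram hsplit hSchN

end X11b

end Summit.BirchSwinnertonDyer.Rank1Residual

end
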